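import Literature.NumberTheory.Transcendental.QuadraticRelationsLogarithmsPlacesBridge
import HarnessLib

/-!
# Roy–Waldschmidt 1997, §5: the height estimates `𝐡₁` used in the proof of Théorème 5.1

D. Roy, M. Waldschmidt, *Approximation diophantienne et indépendance algébrique de logarithmes*,
Ann. Sci. ÉNS (4) 30 (1997) 753–796, proof of Théorème 5.1, p. 782 ("la hauteur `𝐡₁` des points
de `Σ` … est majorée par …") and §4 p. 772 (the affine function-field height `𝐡₁`).

The §5 assembly (`…Sec5Assembly.lean`) states the hypotheses of Théorème 4.1 with the height
`ffHeight₁` of `…Places.lean`; the sibling seat's §4 library (`…Sec4Heights.lean`) proves the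
arithmetic of heights for `affHeight ℚ`, and `…PlacesBridge.lean` proves
`(ffHeight₁ x : ℤ) = affHeight ℚ x`.  This file transports the four estimates the assembly needs:

* `ffHeight₁_comp_le'`, `ffHeight₁_apply_le` — sub-tuples;
* `ffHeight₁_linearComb_le` — **`𝐡₁((∑ₘ c_{s,m} xₘ)_s) ≤ 𝐡₁((xₘ)_m)`** for constant (algebraic)
  coefficients, in particular natural numbers (`ffHeight₁_natLinearComb_le`): the heights of the
  additive coordinates of ALL the points of the box `Σ` are bounded independently of its size
  (ultrametric inequality place by place, `min_ordVec_le_of_linearComb`);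
* `ffHeight₁_prod_pow_le` — `𝐡₁(∏ₘ xₘ^{sₘ}) ≤ ∑ₘ sₘ 𝐡₁(xₘ)`;
* `ffHeight₁_eq_zero_of_isAlgebraic` — constants have height `0`.

Everything is proved; no definitions, no named facts.

## References

* [RoyWaldschmidt1997ENS] D. Roy, M. Waldschmidt, Ann. Sci. ÉNS (4) 30 (1997) 753–796, §4 p. 772,
  §5 p. 782.
-/

noncomputable section

namespace Literature.NumberTheory.Transcendental

namespace RoyWaldschmidt1997

open Literature.NumberTheory.DiophantineGeometry
open Literature.NumberTheory.DiophantineGeometry.AlgFunctionField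

section general

variable {k : Type*} {F : Type*} [Field k] [Field F] [Algebra k F]

/-- Place by place: if `y_s = ∑ₘ c_{s,m} xₘ` with all `c_{s,m} ∈ 𝒪_q`, then
`min{0, ord_q(x)} ≤ min{0, ord_q(y)}` (ultrametric inequality). [cite: RoyWaldschmidt1997ENS, §4, p. 772] -/
theorem min_ordVec_le_of_linearComb {μ σ : Type*} [Fintype μ] [Fintype σ]
    (q : PlaceOver k F) (x : μ → F) (c : σ → μ → F) (hc : ∀ s m, c s m ∈ q.toValuationSubring) :
    min 0 (ordVec q x) ≤ min 0 (ordVec q (fun s => ∑ m, c s m * x m)) := by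
  classical
  set y : σ → F := fun s => ∑ m, c s m * x m with hy_def
  by_cases hy : y = 0
  · rw [hy, ordVec_zero, min_self]; exact min_le_left _ _
  set M := min 0 (ordVec q x) with hM
  have hM0 : M ≤ 0 := min_le_left _ _
  suffices h : M ≤ ordVec q y from le_min hM0 h
  rw [le_ordVec_iff q hy]
  intro s hs
  rw [← q.valuation_le_zpow_iff_le_ord hs M]
  have hys : y s = ∑ m, c s m * x m := rfl
  rw [hys]
  apply Valuation.map_sum_le
  intro m _
  rw [map_mul]
  by_cases hxm : x m = 0
  · simp [hxm]
  have h1 : q.valuation (c s m) ≤ 1 := (q.toValuationSubring.valuation_le_one_iff _).mpr (hc s m)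
  have h2 : q.valuation (x m) ≤ q.valuation (q.uniformizer : F) ^ M := by
    rw [q.valuation_le_zpow_iff_le_ord hxm]
    exact (min_le_right _ _).trans (ordVec_le q hxm)
  calc q.valuation (c s m) * q.valuation (x m)
      ≤ 1 * q.valuation (q.uniformizer : F) ^ M := mul_le_mul' h1 h2
    _ = _ := one_mul _

/-- **`h₁((∑ₘ c_{s,m} xₘ)_s) ≤ h₁(x)`** for coefficients algebraic over the constants.
[cite: RoyWaldschmidt1997ENS, §4, p. 772] -/
theorem affHeight_linearComb_le [IsAlgFunctionField k F] {μ σ : Type*} [Fintype μ] [Fintype σ]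
    (x : μ → F) (c : σ → μ → F) (hc : ∀ s m, IsAlgebraic k (c s m)) :
    affHeight k (fun s => ∑ m, c s m * x m) ≤ affHeight k x :=
  affHeight_le_of_forall fun q => min_ordVec_le_of_linearComb q x c fun s m =>
    IsAlgFunctionField.mem_valuationSubring_of_isAlgebraic _ q.algebraMap_mem (hc s m)

end general

variable {K : IntermediateField ℚ ℂ}

/-- Sub-tuples: `𝐡₁(x ∘ f) ≤ 𝐡₁(x)`. [cite: RoyWaldschmidt1997ENS, §4, p. 772] -/
theorem ffHeight₁_comp_le' [IsAlgFunctionField ℚ K] {ι ι' : Type*} [Fintype ι] [Fintype ι']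
    (x : ι → K) (f : ι' → ι) : ffHeight₁ (x ∘ f) ≤ ffHeight₁ x := by
  have h := affHeight_comp_le (k := ℚ) x f
  rw [← natCast_ffHeight₁, ← natCast_ffHeight₁] at h
  exact_mod_cast h

/-- `𝐡₁(xᵢ) ≤ 𝐡₁(x)`. [cite: RoyWaldschmidt1997ENS, §4, p. 772] -/
theorem ffHeight₁_apply_le [IsAlgFunctionField ℚ K] {ι : Type*} [Fintype ι] (x : ι → K) (i : ι) :
    ffHeight₁ (fun _ : Unit => x i) ≤ ffHeight₁ x :=
  ffHeight₁_comp_le' x (fun _ : Unit => i)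

/-- **Linear combinations with constant coefficients do not increase `𝐡₁`**:
`𝐡₁((∑ₘ c_{s,m} xₘ)_s) ≤ 𝐡₁((xₘ)ₘ)`. [cite: RoyWaldschmidt1997ENS, §4, p. 772 and §5, p. 782] -/
theorem ffHeight₁_linearComb_le [IsAlgFunctionField ℚ K] {μ σ : Type*} [Fintype μ] [Fintype σ]
    (x : μ → K) (c : σ → μ → K) (hc : ∀ s m, IsAlgebraic ℚ (c s m)) :
    ffHeight₁ (fun s => ∑ m, c s m * x m) ≤ ffHeight₁ x := by
  have h := affHeight_linearComb_le (k := ℚ) x c hc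
  rw [← natCast_ffHeight₁, ← natCast_ffHeight₁] at h
  exact_mod_cast h

/-- The case of natural-number coefficients (the additive coordinates of the points of the box `Σ`).
[cite: RoyWaldschmidt1997ENS, §5, p. 782] -/
theorem ffHeight₁_natLinearComb_le [IsAlgFunctionField ℚ K] {μ σ : Type*} [Fintype μ] [Fintype σ]
    (x : μ → K) (c : σ → μ → ℕ) :
    ffHeight₁ (fun s => ∑ m, (c s m : K) * x m) ≤ ffHeight₁ x :=
  ffHeight₁_linearComb_le x (fun s m => (c s m : K)) fun _ _ => isAlgebraic_nat _

/-- Constants have height `0`. [cite: RoyWaldschmidt1997ENS, §4, p. 773] -/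
theorem ffHeight₁_eq_zero_of_isAlgebraic [IsAlgFunctionField ℚ K] {ι : Type*} [Fintype ι]
    {x : ι → K} (hx : ∀ i, IsAlgebraic ℚ (x i)) : ffHeight₁ x = 0 := by
  have h := affHeight_eq_zero_of_isAlgebraic (k := ℚ) hx
  rw [← natCast_ffHeight₁] at h
  exact_mod_cast h

/-- **`𝐡₁(∏ₘ xₘ^{sₘ}) ≤ ∑ₘ sₘ 𝐡₁(xₘ)`** (multiplicative coordinates of the points of `Σ`).
[cite: RoyWaldschmidt1997ENS, §4, p. 772 and §5, p. 782] -/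
theorem ffHeight₁_prod_pow_le [IsAlgFunctionField ℚ K] {μ : Type*} [Fintype μ] (x : μ → K) (s : μ → ℕ) :
    ffHeight₁ (fun _ : Unit => ∏ m, x m ^ s m) ≤ ∑ m, s m * ffHeight₁ (fun _ : Unit => x m) := by
  classical
  have h1 := affHeight_prod_le (k := ℚ) (Finset.univ : Finset μ) (fun m => x m ^ s m)
  have h2 : ∑ m, affHeight ℚ ![x m ^ s m] ≤ ∑ m, (s m : ℤ) * affHeight ℚ ![x m] :=
    Finset.sum_le_sum fun m _ => affHeight_pow_le (k := ℚ) (x m) (s m)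
  have h := h1.trans h2
  rw [← natCast_ffHeight₁_single] at h
  simp_rw [← natCast_ffHeight₁_single] at h
  exact_mod_cast h

end RoyWaldschmidt1997

end Literature.NumberTheory.Transcendental
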